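import Summits.BirchSwinnertonDyer.BirchSwinnertonDyer.Theorems.PrintCFramBottomClassIndexLawFiveLeBorelOLinearPairing
import Summits.BirchSwinnertonDyer.BirchSwinnertonDyer.Theorems.PrintCFramBottomClassIndexLawFiveLeBorelConjugationSqrt
import HarnessLib

/-!
# Route `PrintCFram`, crux C2 `BottomClassIndexLawFiveLe` (stmt-BirchSwinnertonDyer-20372), line
# `eisenstein-resource-bdp-line` (S2 `stub_kolyvaginUpper_borelCM_pairSum_offKrizLi`, structure of
# `H¹(F, W[p^M])` as an `𝓞`-module with involution): **`σ_* ∘ μ_* = −μ_* ∘ σ_*`** — the action of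
# `√−p` on `H¹(F, W[p^M])` ANTI-commutes with the action of complex conjugation, so `√−p` swaps the
# eigenspaces `H¹(F, W[p^M])^±` of McCallum §3 / Gross §5 (5.1)
# (cell `bsd-print-cfram`, seat `bsd-line-cfram-p1-w2` g5; helper `--supports` 20372; 0 facts, 0 defs)

HONEST FRAMING. Nothing about BSD is proved here, and nothing of S2 itself. File 13 proved that
complex conjugation anti-commutes with `μ = √−p` on points; file 15 that `μ` acts on cohomology
compatibly with the Kolyvagin pairing (`[μ_* x, ρ] = μ[x, ρ]`). Here both are combined with the
injectivity (α) over `F` (file 9): for a number field `F ∋ √−p` with `(p−1) ∤ [F:ℚ]`, an involution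
`σ ∈ Aut(F/ℚ)` lifted to `τ = absGaloisTransport c₀` through a complex conjugation `c₀`, any additive
`ψ` on `W(F̄)[p^M]` agreeing with `μ` through `θ`, and any additive `Mψ` on `H¹(F, W[p^M])` with
`[Mψ x, ρ] = ψ[x, ρ]`:
* `torsionMap_apply_add_apply_torsionMap` — `τ(ψ t) + ψ(τ t) = 0` on `W(F̄)[p^M]`;
* **`conjAct_apply_add_apply_conjAct_eq_zero`** — `σ_*(Mψ x) + Mψ(σ_* x) = 0` on `H¹(F, W[p^M])`
  (the two sides have the same evaluations on `Γ_{F(W[p^M])}`, so agree by (α));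
* `conjAct_apply_eq_neg_smul_of_eigen` — if `σ_* x = ν x` then `σ_*(Mψ x) = −ν · Mψ x`: `√−p` maps
  `H¹(F, W[p^M])^{ν}` to `H¹(F, W[p^M])^{−ν}`. So in McCallum's Prop. 3.1 at the Borel prime the pair
  `(g₁ ∈ H¹⁺, g₂ ∈ H¹⁻)` may be taken as `(g, √−p·g)` for ONE `𝓞`-generator — the `𝓞`-linear recast.
THEOREMS ONLY; no definition, no named fact, no `sorry`. BSD is not proved by any of this; no summit
statement is proved by this seat.
References: [GrossLMS1991] §5 (5.1), §9; [McCallumLMS1991] §3; [Rubin1999] Cor. 5.5.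
-/

set_option autoImplicit false
-- `…BirchSwinnertonDyer.BirchSwinnertonDyer.Theorems…` is the problem's mandated namespace (D-0017).
set_option linter.dupNamespace false

noncomputable section

open scoped Classical

namespace Summit.BirchSwinnertonDyer.BirchSwinnertonDyer.Theorems.PrintCFram.BorelKolyvaginPairing

open WeierstrassCurve Field Literature.NumberTheory.EllipticCurves
  Literature.NumberTheory.EllipticCurves.KolyvaginPairing Literature.NumberTheory.GaloisRepresentations
  Literature.NumberTheory.EllipticCurves.Rank1Residual
  Summit.BirchSwinnertonDyer.BirchSwinnertonDyer.Theorems.PrintCFram.BorelHomothety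

section ConjMu

variable (W : WeierstrassCurve ℚ) [W.IsElliptic] (p : ℕ) [hp : Fact p.Prime]
variable (F : Type) [Field F] [NumberField F]
variable {σ : F ≃ₐ[ℚ] F} {τ : AlgebraicClosure F ≃+* AlgebraicClosure F} {c₀ : absoluteGaloisGroup ℚ}

omit [W.IsElliptic] in
/-- **`τ(ψ t) + ψ(τ t) = 0` on `W(F̄)[n]`**: the lift of complex conjugation anti-commutes with
`√−p` (`apply_smul_eq_neg_of_isComplexConjugation`, transported along `θ`). [cite: Rubin1999, Cor. 5.5] -/
theorem torsionMap_apply_add_apply_torsionMap (hτ : IsLiftOfAut σ τ)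
    (hγ : ∀ x, τ x = absGaloisTransport (K := ℚ) (L := F) c₀ x)
    (hc₀ : IsComplexConjugation (Rat.castHom ℝ) c₀) {s : AlgebraicClosure ℚ}
    {μ : AddMonoid.End W.geomPoints} (hs : s ^ 2 = ((-(p : ℤ) : ℤ) : AlgebraicClosure ℚ))
    (hanti : ∀ g : absoluteGaloisGroup ℚ, g • s = -s → ∀ P, μ (g • P) = -(g • μ P))
    {n : ℤ} (ψ : geomTorsion (W.baseChange F) n →+ geomTorsion (W.baseChange F) n)
    (hψ : ∀ t, (((RatClosure.torsionEquiv (K := F) W n).symm (ψ t) : W.geomTorsion n) : W.geomPoints) =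
      μ ((RatClosure.torsionEquiv (K := F) W n).symm t : W.geomTorsion n))
    (t : geomTorsion (W.baseChange F) n) :
    hτ.torsionMap W n (ψ t) + ψ (hτ.torsionMap W n t) = 0 := by
  set θ := RatClosure.torsionEquiv (K := F) W n with hθ
  -- `ψ` through `θ`: `ψ (θ t₀) = θ ⟨μ t₀⟩`
  have hψθ : ∀ t₀ : W.geomTorsion n,
      ((θ.symm (ψ (θ t₀)) : W.geomTorsion n) : W.geomPoints) = μ (t₀ : W.geomPoints) := fun t₀ => by
    rw [hψ, θ.symm_apply_apply]
  obtain ⟨t₀, rfl⟩ := θ.surjective t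
  apply θ.symm.injective
  rw [map_add, map_zero]
  apply Subtype.ext
  rw [AddSubgroup.coe_add, ZeroMemClass.coe_zero]
  -- first summand: `θ⁻¹ τ (ψ (θ t₀)) = c₀ • θ⁻¹(ψ (θ t₀))`, with value `c₀ • μ t₀`
  have h1 : ((θ.symm (hτ.torsionMap W n (ψ (θ t₀))) : W.geomTorsion n) : W.geomPoints) =
      c₀ • μ (t₀ : W.geomPoints) := by
    have e1 : hτ.torsionMap W n (ψ (θ t₀)) = θ (c₀ • θ.symm (ψ (θ t₀))) := by
      rw [RatClosure.torsionEquiv_smul_of_lift W hτ c₀ hγ n, θ.apply_symm_apply]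
    rw [e1, θ.symm_apply_apply]
    change c₀ • ((θ.symm (ψ (θ t₀)) : W.geomTorsion n) : W.geomPoints) = _
    rw [hψθ]
  -- second summand: `θ⁻¹ ψ (τ (θ t₀)) = μ (c₀ • t₀)`
  have h2 : ((θ.symm (ψ (hτ.torsionMap W n (θ t₀))) : W.geomTorsion n) : W.geomPoints) =
      μ (c₀ • (t₀ : W.geomPoints)) := by
    rw [← RatClosure.torsionEquiv_smul_of_lift W hτ c₀ hγ n t₀, hψθ]
    rfl
  rw [h1, h2, apply_smul_eq_neg_of_isComplexConjugation p hc₀ hs hanti, add_neg_cancel]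

/-- **`σ_*(μ_* x) + μ_*(σ_* x) = 0` on `H¹(F, W[p^M])`.** `W/ℚ` CM, `p ≥ 5` CM-ramified, `μ = √−p`
with its sign rule; `F ∋ √−p` with `(p−1) ∤ [F:ℚ]`; `σ ∈ Aut(F/ℚ)` with an involutive lift
`τ = absGaloisTransport c₀` through a complex conjugation `c₀`; `ψ` agreeing with `μ` through `θ`;
`Mψ` compatible with `ψ` under evaluation (`h1Eval_coeffMap`); `M ≥ 1`. The two classes have the
same evaluations on `Γ_{F(W[p^M])}` (`h1Eval_conjAct`, the compatibility, and
`τψ + ψτ = 0`), hence agree by the injectivity (α) over `F`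
(`eq_zero_of_forall_h1Eval_eq_zero_of_sqrt_mem`). [cite: GrossLMS1991, §5 (5.1), §9]
[cite: McCallumLMS1991, §3] -/
theorem conjAct_apply_add_apply_conjAct_eq_zero (hCM : W.HasCM) (h5 : 5 ≤ p) (hram : CMRamified W p)
    (hτ : IsLiftOfAut σ τ) (hinv : ∀ x, τ (τ x) = x)
    (hγ : ∀ x, τ x = absGaloisTransport (K := ℚ) (L := F) c₀ x)
    (hc₀ : IsComplexConjugation (Rat.castHom ℝ) c₀) {s : AlgebraicClosure ℚ}
    {μ : AddMonoid.End W.geomPoints} (hs : s ^ 2 = ((-(p : ℤ) : ℤ) : AlgebraicClosure ℚ))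
    (hanti : ∀ g : absoluteGaloisGroup ℚ, g • s = -s → ∀ P, μ (g • P) = -(g • μ P))
    (hF : ∃ y : F, y ^ 2 = -(p : F)) (hdeg : ¬ (p - 1) ∣ Module.finrank ℚ F) {M : ℕ} (hM : 1 ≤ M)
    (ψ : geomTorsion (W.baseChange F) ((p ^ M : ℕ) : ℤ) →+ geomTorsion (W.baseChange F) ((p ^ M : ℕ) : ℤ))
    (hψ : ∀ t, (((RatClosure.torsionEquiv (K := F) W ((p ^ M : ℕ) : ℤ)).symm (ψ t) :
        W.geomTorsion ((p ^ M : ℕ) : ℤ)) : W.geomPoints) =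
      μ ((RatClosure.torsionEquiv (K := F) W ((p ^ M : ℕ) : ℤ)).symm t : W.geomTorsion ((p ^ M : ℕ) : ℤ)))
    (Mψ : galH1Torsion (W.baseChange F) ((p ^ M : ℕ) : ℤ) →+ galH1Torsion (W.baseChange F) ((p ^ M : ℕ) : ℤ))
    (hMψ : ∀ (x : galH1Torsion (W.baseChange F) ((p ^ M : ℕ) : ℤ)) {ρ : absoluteGaloisGroup F},
      ρ ∈ torsionFixing (W.baseChange F) ((p ^ M : ℕ) : ℤ) →
        h1Eval (W.baseChange F) ((p ^ M : ℕ) : ℤ) (Mψ x) ρ = ψ (h1Eval (W.baseChange F) ((p ^ M : ℕ) : ℤ) x ρ))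
    (x : galH1Torsion (W.baseChange F) ((p ^ M : ℕ) : ℤ)) :
    conjAct W σ ((p ^ M : ℕ) : ℤ) (Mψ x) + Mψ (conjAct W σ ((p ^ M : ℕ) : ℤ) x) = 0 := by
  refine eq_zero_of_forall_h1Eval_eq_zero_of_sqrt_mem W p F hCM h5 hram hF hdeg hM fun ρ hρ => ?_
  have hρ' := hτ.conjGalCMH_mem_torsionFixing W hinv _ hρ
  rw [h1Eval_add _ _ _ _ hρ, hτ.h1Eval_conjAct W _ _ hρ, hMψ x hρ', hMψ _ hρ, hτ.h1Eval_conjAct W _ _ hρ]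
  exact torsionMap_apply_add_apply_torsionMap W p F hτ hγ hc₀ hs hanti ψ hψ _

/-- **`√−p` swaps the `±`-eigenspaces of complex conjugation on `H¹(F, W[p^M])`**: under the
hypotheses of `conjAct_apply_add_apply_conjAct_eq_zero`, if `σ_* x = ν x` then
`σ_*(Mψ x) = −(ν · Mψ x)`. [cite: GrossLMS1991, §5 (5.1)] [cite: McCallumLMS1991, §3] -/
theorem conjAct_apply_eq_neg_smul_of_eigen (hCM : W.HasCM) (h5 : 5 ≤ p) (hram : CMRamified W p)
    (hτ : IsLiftOfAut σ τ) (hinv : ∀ x, τ (τ x) = x)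
    (hγ : ∀ x, τ x = absGaloisTransport (K := ℚ) (L := F) c₀ x)
    (hc₀ : IsComplexConjugation (Rat.castHom ℝ) c₀) {s : AlgebraicClosure ℚ}
    {μ : AddMonoid.End W.geomPoints} (hs : s ^ 2 = ((-(p : ℤ) : ℤ) : AlgebraicClosure ℚ))
    (hanti : ∀ g : absoluteGaloisGroup ℚ, g • s = -s → ∀ P, μ (g • P) = -(g • μ P))
    (hF : ∃ y : F, y ^ 2 = -(p : F)) (hdeg : ¬ (p - 1) ∣ Module.finrank ℚ F) {M : ℕ} (hM : 1 ≤ M)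
    (ψ : geomTorsion (W.baseChange F) ((p ^ M : ℕ) : ℤ) →+ geomTorsion (W.baseChange F) ((p ^ M : ℕ) : ℤ))
    (hψ : ∀ t, (((RatClosure.torsionEquiv (K := F) W ((p ^ M : ℕ) : ℤ)).symm (ψ t) :
        W.geomTorsion ((p ^ M : ℕ) : ℤ)) : W.geomPoints) =
      μ ((RatClosure.torsionEquiv (K := F) W ((p ^ M : ℕ) : ℤ)).symm t : W.geomTorsion ((p ^ M : ℕ) : ℤ)))
    (Mψ : galH1Torsion (W.baseChange F) ((p ^ M : ℕ) : ℤ) →+ galH1Torsion (W.baseChange F) ((p ^ M : ℕ) : ℤ))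
    (hMψ : ∀ (x : galH1Torsion (W.baseChange F) ((p ^ M : ℕ) : ℤ)) {ρ : absoluteGaloisGroup F},
      ρ ∈ torsionFixing (W.baseChange F) ((p ^ M : ℕ) : ℤ) →
        h1Eval (W.baseChange F) ((p ^ M : ℕ) : ℤ) (Mψ x) ρ = ψ (h1Eval (W.baseChange F) ((p ^ M : ℕ) : ℤ) x ρ))
    {x : galH1Torsion (W.baseChange F) ((p ^ M : ℕ) : ℤ)} {ν : ℤ}
    (hx : conjAct W σ ((p ^ M : ℕ) : ℤ) x = ν • x) :
    conjAct W σ ((p ^ M : ℕ) : ℤ) (Mψ x) = -(ν • Mψ x) := by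
  have h := conjAct_apply_add_apply_conjAct_eq_zero W p F hCM h5 hram hτ hinv hγ hc₀ hs hanti hF hdeg
    hM ψ hψ Mψ hMψ x
  rw [hx, map_zsmul] at h
  exact eq_neg_of_add_eq_zero_left h

end ConjMu

end Summit.BirchSwinnertonDyer.BirchSwinnertonDyer.Theorems.PrintCFram.BorelKolyvaginPairing

end
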